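import Literature.NumberTheory.EllipticCurves.ZpExtensionShapiroToEisensteinLevelMap
import Literature.NumberTheory.EllipticCurves.ZpExtensionEisensteinTwistFreeProofs
import Literature.NumberTheory.GaloisCohomology.Howard2004.SemilinearRingChange
import Mathlib.LinearAlgebra.TensorProduct.RightExactness
import HarnessLib

/-!
# The level maps `E[p^σ] ⊗ Λ/(ω_σ, p^σ) ↠ E[p^k] ⊗ A_{m,k}` of the Kolyvagin-system pushforward PRESENT A BASE
# CHANGE (`Howard2004.IsBaseChangeBy`): kernel `= (ker (Λ/I_σ ↠ A_{m,k})) · source` (theorems only)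

Topic `NumberTheory/EllipticCurves` (sequel of `ZpExtensionShapiroToEisensteinLevelMap`; cell `pub/bsd-print-x9`, seat
`bsd-line-x9-p2` g4, STUB A of the shared μ-crux `MuInequalityCoherentPair`).  Howard, Rem. 1.2.4 [arXiv:1202.6340
Rem. 2.2.4, p. 7 L13–27] / proof of Thm. 2.2.10 (first sentence): the Kolyvagin-system map
`KS(𝐓, F_Λ, 𝓛) → KS(T_𝔭, F_𝔭, 𝓛)` is the change of coefficient ring `𝐓 ↦ 𝐓 ⊗_Λ S_𝔭 = T_𝔭`.  On the finite levels
of the cell's towers this is the map `f_{σ,k} : E[p^σ] ⊗ (Λ/(ω_σ,p^σ))(χ) ↠ E[p^k] ⊗ A_{m,k}(χ)`, `[c] ⊗ P ↦ [c] ⊗ p^{σ−k}P`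
(`shapiroToEisensteinTwistLe`, p652954 / `shapiroToEisensteinLevelMap`, p653849).  The tree's instance-free predicate
`IsBaseChangeBy ρ φ ρ' f` (lit, `Howard2004/SemilinearRingChange`: «`f` presents `T′ = T ⊗_R R′` along the surjection
`φ : R ↠ R′`»: `φ`, `f` surjective, `f` `φ`-semilinear and equivariant, `ker f ⊆ (ker φ)·T`) is exactly what the
generic `Hom` constructor `CoeffTowerSetting.Hom.ofBaseChange` (x9-p2 g4, `Howard2004/TowerMorphismOfBaseChange`)
consumes to BUILD the maps of the Kolyvagin quotients.  This file proves it for `f_{σ,k}`: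

* §1 (pure algebra, right exactness of `⊗_ℤ`, Mathlib `TensorProduct.map_ker`)
  `ZpExtension.mem_ker_smul_top_of_coeffTwistReduceLinear_eq_zero`: for `φ : A ↠ A′` and `f : M ↠ M′` with
  `ker f = c·M` for an integer `c` vanishing in `A′`, `(φ ⊗ f) x = 0 ⇒ x ∈ (ker φ)·(A ⊗ M)`;
* §2 (the curve) `WeierstrassCurve.torsionGaloisModulePowReduce_surjective` and `…_eq_zero_iff`
  (`p^{σ−k}· : E[p^σ] ↠ E[p^k]` is onto with kernel `p^k E[p^σ]`; divisibility of `E(K̄)`);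
* §3 **`ZpExtension.isBaseChangeBy_shapiroToEisensteinTwistLe`** (on the pinned carriers) and
  **`ZpExtension.isBaseChangeBy_shapiroToEisensteinLevelMap`** (on the level synonyms `CoeffLevel` / `EisensteinLevel`,
  the form `Hom.ofBaseChange` takes, along the LEVEL-ring map `shapiroToEisensteinCoeff : Λ/(ω_σ,p^σ) ↠ A_{m,k}`).
Theorems only; no named fact, no instance, no notation, no `sorry`.  BSD is not proved by any of this.

References: [Howard2004HeegnerKolyvagin] Rem. 1.2.4, H.0, §2.2, proof of Thm. 2.2.10 (arXiv Thm. 3.2.10, p. 17 L78–81);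
[BourbakiAlgebre1a3] Ch. II §3 no. 6 Prop. 6 (kernel of `u ⊗ v` for surjective `u`, `v`); [SilvermanAEC2009] III.§7, VIII.§2.
-/

noncomputable section

open scoped TensorProduct Topology Classical ContRepresentation
open Field CategoryTheory IsLocalRing

universe u

/-! ## §1 Right exactness: the kernel of a coefficient change `φ ⊗ f` with `ker f = c·M`, `c = 0` in `A′` -/

namespace Literature.NumberTheory.EllipticCurves.ZpExtension

open Literature.NumberTheory.GaloisRepresentations

/-- **`(φ ⊗ f) x = 0 ⇒ x ∈ (ker φ)·(A ⊗ M)`** for surjective `φ : A ↠ A′`, `f : M ↠ M′` with `ker f = c·M` for an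
integer `c` with `c = 0` in `A′` (so `c ∈ ker φ`): the kernel of `φ ⊗ f` is generated by `(ker φ) ⊗ M` and
`A ⊗ ker f = A ⊗ cM = c·(A ⊗ M)` (right exactness of `⊗_ℤ`, Mathlib `TensorProduct.map_ker`), both inside
`(ker φ)·(A ⊗ M)`.  Plain tensor-product form.
[cite: BourbakiAlgebre1a3, Ch. II §3 no. 6 Prop. 6] [cite: Howard2004HeegnerKolyvagin, Rem. 1.2.4 (T ↦ T ⊗_R R′ = T/JT)] -/
theorem TensorProduct.mem_ker_smul_top_of_map_eq_zero {A A' : Type} [CommRing A] [CommRing A'] (φ : A →+* A')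
    (hφ : Function.Surjective φ) {M M' : Type u} [AddCommGroup M] [AddCommGroup M'] (f : M →ₗ[ℤ] M')
    (hf : Function.Surjective f) (c : ℤ) (hker : ∀ x : M, f x = 0 ↔ ∃ y : M, x = c • y) (hc : (c : A') = 0)
    {x : A ⊗[ℤ] M} (hx : TensorProduct.map φ.toAddMonoidHom.toIntLinearMap f x = 0) :
    x ∈ (RingHom.ker φ • (⊤ : Submodule A (A ⊗[ℤ] M)) : Submodule A (A ⊗[ℤ] M)) := by
  -- the two exact pairs `ker φ ↪ A ↠ A′` and `M --(c •)--> M ↠ M′`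
  have hexg : Function.Exact ((RingHom.ker φ).subtype.toAddMonoidHom.toIntLinearMap)
      (φ.toAddMonoidHom.toIntLinearMap) := by
    intro a
    constructor
    · intro ha
      exact ⟨⟨a, ha⟩, rfl⟩
    · rintro ⟨j, rfl⟩
      exact j.2
  have hexf : Function.Exact (DistribSMul.toLinearMap ℤ M c) f := by
    intro y
    rw [hker]
    constructor
    · rintro ⟨z, rfl⟩
      exact ⟨z, rfl⟩
    · rintro ⟨z, rfl⟩
      exact ⟨z, rfl⟩
  have hmem : x ∈ LinearMap.ker (TensorProduct.map φ.toAddMonoidHom.toIntLinearMap f) := hx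
  rw [TensorProduct.map_ker hexg hφ hexf hf, Submodule.mem_sup] at hmem
  obtain ⟨y, ⟨y', rfl⟩, z, ⟨z', rfl⟩, rfl⟩ := hmem
  have hcA : (c : A) ∈ RingHom.ker φ := by
    rw [RingHom.mem_ker, map_intCast, hc]
  clear hx
  refine Submodule.add_mem _ ?_ ?_
  · -- `A ⊗ cM = c·(A ⊗ M) ⊆ (ker φ)·(A ⊗ M)`
    induction y' using TensorProduct.induction_on with
    | zero => rw [map_zero]; exact Submodule.zero_mem _
    | tmul a y =>
      rw [LinearMap.lTensor_tmul, DistribSMul.toLinearMap_apply]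
      have h1 : (a ⊗ₜ[ℤ] (c • y) : A ⊗[ℤ] M) = (c : A) • (a ⊗ₜ[ℤ] y) := by
        rw [TensorProduct.tmul_smul, TensorProduct.smul_tmul', TensorProduct.smul_tmul', zsmul_eq_mul, smul_eq_mul]
      rw [h1]
      exact Submodule.smul_mem_smul hcA Submodule.mem_top
    | add y₁ y₂ hy₁ hy₂ => rw [map_add]; exact Submodule.add_mem _ hy₁ hy₂
  · -- `(ker φ) ⊗ M ⊆ (ker φ)·(A ⊗ M)`
    induction z' using TensorProduct.induction_on with
    | zero => rw [map_zero]; exact Submodule.zero_mem _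
    | tmul j y =>
      rw [LinearMap.rTensor_tmul]
      change ((j : A) ⊗ₜ[ℤ] y : A ⊗[ℤ] M) ∈ _
      have h1 : ((j : A) ⊗ₜ[ℤ] y : A ⊗[ℤ] M) = (j : A) • ((1 : A) ⊗ₜ[ℤ] y) := by
        rw [TensorProduct.smul_tmul', smul_eq_mul, mul_one]
      rw [h1]
      exact Submodule.smul_mem_smul j.2 Submodule.mem_top
    | add y₁ y₂ hy₁ hy₂ => rw [map_add]; exact Submodule.add_mem _ hy₁ hy₂

/-- **The same in the currency of the coefficient-extended modules** `CoeffExtension ℤ A M` and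
`coeffTwistReduceLinear φ f` (the additive map under `ZpExtension.coeffTwistReduce`): `(φ ⊗ f) x = 0 ⇒
x ∈ (ker φ)·(A ⊗ M)`. [cite: BourbakiAlgebre1a3, Ch. II §3 no. 6 Prop. 6] [cite: Howard2004HeegnerKolyvagin, Rem. 1.2.4] -/
theorem mem_ker_smul_top_of_coeffTwistReduceLinear_eq_zero {A A' : Type} [CommRing A] [CommRing A'] (φ : A →+* A')
    (hφ : Function.Surjective φ) {M M' : Type u} [AddCommGroup M] [AddCommGroup M'] (f : M →ₗ[ℤ] M')
    (hf : Function.Surjective f) (c : ℤ) (hker : ∀ x : M, f x = 0 ↔ ∃ y : M, x = c • y) (hc : (c : A') = 0)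
    {x : CoeffExtension ℤ A M} (hx : coeffTwistReduceLinear φ f x = 0) :
    x ∈ (RingHom.ker φ • (⊤ : Submodule A (CoeffExtension ℤ A M)) : Submodule A (CoeffExtension ℤ A M)) :=
  TensorProduct.mem_ker_smul_top_of_map_eq_zero φ hφ f hf c hker hc hx

end Literature.NumberTheory.EllipticCurves.ZpExtension

/-! ## §2 `p^{σ−k}· : E[p^σ] ↠ E[p^k]` is onto with kernel `p^k E[p^σ]` -/

namespace WeierstrassCurve

open Literature.NumberTheory.EllipticCurves Literature.NumberTheory.GaloisRepresentations

variable {F : Type} [Field F] (W : WeierstrassCurve F) [W.IsElliptic] (p : ℕ) [hp : Fact p.Prime]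

/-- **`p^{σ−k}· : E[p^σ] → E[p^k]` is surjective** (`E(F̄)` is divisible: a `p^{σ−k}`-th root of a `p^k`-torsion point
is `p^σ`-torsion). [cite: SilvermanAEC2009, §VIII.2 (0 → E[m] → E(K̄) → E(K̄) → 0)] [cite: Howard2004HeegnerKolyvagin, §1.6 (surjective reductions of the tower)] -/
theorem torsionGaloisModulePowReduce_surjective (σ k : ℕ) (h : k ≤ σ) :
    Function.Surjective (W.torsionGaloisModulePowReduce p σ k h) := by
  intro R
  obtain ⟨Q₀, hQ₀⟩ := W.zsmul_geomPoints_surjective_holds (n := (p : ℤ) ^ (σ - k))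
    (pow_ne_zero _ (by exact_mod_cast hp.out.ne_zero)) (R : geomPoints W)
  change ((p : ℤ) ^ (σ - k)) • Q₀ = (R : geomPoints W) at hQ₀
  have hQ₀mem : Q₀ ∈ geomTorsion W ((p : ℤ) ^ σ) := by
    rw [mem_geomTorsion_iff, ← Nat.add_sub_cancel' h, pow_add, ← smul_smul, hQ₀]
    exact (mem_geomTorsion_iff W _ _).mp R.2
  exact ⟨⟨Q₀, hQ₀mem⟩, Subtype.ext (by rw [coe_torsionGaloisModulePowReduce]; exact hQ₀)⟩

/-- **The kernel of `p^{σ−k}· : E[p^σ] → E[p^k]` is `p^k · E[p^σ]`** (`= E[p^{σ−k}]`; divisibility again).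
[cite: SilvermanAEC2009, §VIII.2, Cor. III.6.4(b)] [cite: Howard2004HeegnerKolyvagin, §1.6 (exact tower) and §2.2] -/
theorem torsionGaloisModulePowReduce_eq_zero_iff (σ k : ℕ) (h : k ≤ σ) (P : geomTorsion W ((p : ℤ) ^ σ)) :
    W.torsionGaloisModulePowReduce p σ k h P = 0 ↔ ∃ Q : geomTorsion W ((p : ℤ) ^ σ), P = ((p : ℤ) ^ k) • Q := by
  constructor
  · intro h0
    have hP : ((p : ℤ) ^ (σ - k)) • (P : geomPoints W) = 0 := by
      rw [← W.coe_torsionGaloisModulePowReduce p σ k h P, h0]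
      rfl
    obtain ⟨Q₀, hQ₀⟩ := W.zsmul_geomPoints_surjective_holds (n := (p : ℤ) ^ k)
      (pow_ne_zero k (by exact_mod_cast hp.out.ne_zero)) (P : geomPoints W)
    change ((p : ℤ) ^ k) • Q₀ = (P : geomPoints W) at hQ₀
    have hQ₀mem : Q₀ ∈ geomTorsion W ((p : ℤ) ^ σ) := by
      rw [mem_geomTorsion_iff, ← Nat.sub_add_cancel h, pow_add, ← smul_smul, hQ₀, hP]
    refine ⟨⟨Q₀, hQ₀mem⟩, Subtype.ext ?_⟩
    rw [AddSubgroupClass.coe_zsmul]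
    exact hQ₀.symm
  · rintro ⟨Q, rfl⟩
    apply Subtype.ext
    rw [coe_torsionGaloisModulePowReduce, ZeroMemClass.coe_zero, AddSubgroupClass.coe_zsmul, smul_smul, ← pow_add,
      Nat.sub_add_cancel h]
    exact (mem_geomTorsion_iff W _ _).mp Q.2

end WeierstrassCurve

/-! ## §3 `f_{σ,k}` presents the base change along `Λ/(ω_σ, p^σ) ↠ A_{m,k}` -/

namespace Literature.NumberTheory.EllipticCurves.ZpExtension

open Literature.NumberTheory.GaloisRepresentations
open Literature.NumberTheory.GaloisCohomology.Howard2004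

variable {K : Type} [Field K] {V : WeierstrassCurve K} [V.IsElliptic] {p : ℕ} [hp : Fact p.Prime]
  (κ : ZpExtension K p)
  (t : ∀ k, (V.torsionGaloisModule ((p : ℤ) ^ (k + 1))).toContRepresentation →ⁱL
    (V.torsionGaloisModule ((p : ℤ) ^ k)).toContRepresentation)
  (hts : ∀ k, Function.Surjective (t k)) {m : ℕ} (hm : 1 ≤ m)

/-- **The level map `[c] ⊗ P ↦ [c] ⊗ p^{σ−k}P` has kernel inside `(ker (Λ/I_σ ↠ A_{m,k})) · (E[p^σ] ⊗ Λ/I_σ)`** (§1 with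
`c := p^k`, which vanishes in `A_{m,k}`, and §2). [cite: Howard2004HeegnerKolyvagin, Rem. 1.2.4 (T_𝔭 = 𝐓 ⊗_Λ S_𝔭 = 𝐓/𝔭𝐓)] [cite: BourbakiAlgebre1a3, Ch. II §3 no. 6 Prop. 6] -/
theorem mem_ker_smul_top_of_shapiroToEisensteinTwistLe_eq_zero (σ k : ℕ) (hσ : k ≤ σ)
    (hle : shapiroIdeal p σ ≤ Ideal.span {(PowerSeries.X ^ m + PowerSeries.C (p : ℤ_[p]) : IwasawaAlgebra p)} ⊔
      Ideal.span {PowerSeries.C ((p : ℤ_[p]) ^ k)})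
    {x : QuotTwisted (IwasawaAlgebra p ⧸ shapiroIdeal p σ) (WeierstrassCurve.geomTorsion V ((p : ℤ) ^ σ))}
    (hx : κ.shapiroToEisensteinTwistLe V hm σ k hσ hle x = 0) :
    x ∈ (RingHom.ker (shapiroToEisensteinCoeff p (m := m) hle) •
        (⊤ : Submodule (IwasawaAlgebra p ⧸ shapiroIdeal p σ)
          (QuotTwisted (IwasawaAlgebra p ⧸ shapiroIdeal p σ) (WeierstrassCurve.geomTorsion V ((p : ℤ) ^ σ)))) :
      Submodule (IwasawaAlgebra p ⧸ shapiroIdeal p σ)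
        (QuotTwisted (IwasawaAlgebra p ⧸ shapiroIdeal p σ) (WeierstrassCurve.geomTorsion V ((p : ℤ) ^ σ)))) := by
  have hc : (((p : ℤ) ^ k : ℤ) : IwasawaAlgebra.EisensteinCoeff p m k) = 0 := by
    rw [Int.cast_pow, Int.cast_natCast, ← Nat.cast_pow]
    exact IwasawaAlgebra.EisensteinCoeff.natCast_prime_pow_eq_zero m k
  exact mem_ker_smul_top_of_coeffTwistReduceLinear_eq_zero (shapiroToEisensteinCoeff p hle)
    (shapiroToEisensteinCoeff_surjective p hle) (V.torsionGaloisModulePowReduce p σ k hσ).toContinuousLinearMap.toLinearMap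
    (V.torsionGaloisModulePowReduce_surjective p σ k hσ) ((p : ℤ) ^ k)
    (fun P ↦ V.torsionGaloisModulePowReduce_eq_zero_iff p σ k hσ P) hc hx

/-- **`f_{σ,k} : E[p^σ] ⊗ (Λ/(ω_σ,p^σ))(χ) ↠ E[p^k] ⊗ A_{m,k}(χ)` PRESENTS THE BASE CHANGE along `Λ/(ω_σ,p^σ) ↠ A_{m,k}`**
(on the pinned carriers): surjective ring map and level map, semilinear, equivariant, kernel inside
`(ker)·source` — Howard's `T_𝔭/p^k = (𝐓/I_σ𝐓) ⊗_{Λ/I_σ} A_{m,k}` at the finite level.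
[cite: Howard2004HeegnerKolyvagin, Rem. 1.2.4 and proof of Thm. 2.2.10 (arXiv p. 7 L13–27, p. 17 L78–81)] -/
theorem isBaseChangeBy_shapiroToEisensteinTwistLe (σ k : ℕ) (hσ : k ≤ σ)
    (hle : shapiroIdeal p σ ≤ Ideal.span {(PowerSeries.X ^ m + PowerSeries.C (p : ℤ_[p]) : IwasawaAlgebra p)} ⊔
      Ideal.span {PowerSeries.C ((p : ℤ_[p]) ^ k)}) :
    IsBaseChangeBy
      (κ.coeffTwist (V.torsionGaloisModule ((p : ℤ) ^ σ)) (coeffLevelUnit (shapiroIdeal p) σ) σ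
        (mk_one_add_X_pow_prime_pow_eq_one (shapiroIdeal p σ) (omega_mem_shapiroIdeal p σ)))
      (shapiroToEisensteinCoeff p (m := m) hle)
      (κ.eisensteinTwist (V.torsionGaloisModule ((p : ℤ) ^ k)) hm k)
      (κ.shapiroToEisensteinTwistLe V hm σ k hσ hle).toContinuousLinearMap.toLinearMap.toAddMonoidHom where
  ringHom_surjective := shapiroToEisensteinCoeff_surjective p hle
  surjective := κ.shapiroToEisensteinTwistLe_surjective hm σ k hσ hle (V.torsionGaloisModulePowReduce_surjective p σ k hσ)
  map_smul r x := κ.shapiroToEisensteinTwistLe_smul hm σ k hσ hle r x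
  ker_le _ hx := κ.mem_ker_smul_top_of_shapiroToEisensteinTwistLe_eq_zero hm σ k hσ hle hx
  equivariant g x := congrArg (fun φ ↦ φ x) ((κ.shapiroToEisensteinTwistLe V hm σ k hσ hle).isIntertwining' g)

/-- **The same on the level SYNONYMS** (`CoeffLevel p (shapiroIdeal p) (E[p^·]) σ` with its `Λ/I_σ`-module structure,
`EisensteinLevel p m (E[p^·]) k` with its `A_{m,k}`-module structure; source representation the level `σ` of the
Shapiro-diagonal `coeffAdicTower`, target `κ.eisensteinTwist E[p^k] hm k`): the hypothesis `hbc` of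
`CoeffTowerSetting.Hom.ofBaseChange` for the level maps `shapiroToEisensteinLevelMap` of the pushforward `Hom`.
[cite: Howard2004HeegnerKolyvagin, Rem. 1.2.4 and proof of Thm. 2.2.10 (arXiv p. 7 L13–27, p. 17 L78–81)] -/
theorem isBaseChangeBy_shapiroToEisensteinLevelMap (σ k : ℕ) (hσ : k ≤ σ)
    (hle : shapiroIdeal p σ ≤ Ideal.span {(PowerSeries.X ^ m + PowerSeries.C (p : ℤ_[p]) : IwasawaAlgebra p)} ⊔
      Ideal.span {PowerSeries.C ((p : ℤ_[p]) ^ k)}) :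
    IsBaseChangeBy
      ((κ.coeffAdicTower (fun j ↦ V.torsionGaloisModule ((p : ℤ) ^ j)) t (shapiroIdeal p) (shapiroIdeal_succ_le p)
        (fun j ↦ j) (omega_mem_shapiroIdeal p) (fun j ↦ j * p ^ j + j) (maximalIdeal_pow_le_shapiroIdeal p) hts).ρ σ)
      (shapiroToEisensteinCoeff p (m := m) hle)
      (κ.eisensteinTwist (V.torsionGaloisModule ((p : ℤ) ^ k)) hm k :
        ContinuousRep (absoluteGaloisGroup K) ℤ (EisensteinLevel p m (fun j ↦ WeierstrassCurve.geomTorsion V ((p : ℤ) ^ j)) k))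
      (κ.shapiroToEisensteinLevelMap V hm σ k hσ hle) where
  ringHom_surjective := shapiroToEisensteinCoeff_surjective p hle
  surjective := κ.shapiroToEisensteinTwistLe_surjective hm σ k hσ hle (V.torsionGaloisModulePowReduce_surjective p σ k hσ)
  map_smul r x := κ.shapiroToEisensteinTwistLe_smul hm σ k hσ hle r
    (x : QuotTwisted (IwasawaAlgebra p ⧸ shapiroIdeal p σ) (WeierstrassCurve.geomTorsion V ((p : ℤ) ^ σ)))
  ker_le x hx := κ.mem_ker_smul_top_of_shapiroToEisensteinTwistLe_eq_zero hm σ k hσ hle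
    (x := (x : QuotTwisted (IwasawaAlgebra p ⧸ shapiroIdeal p σ) (WeierstrassCurve.geomTorsion V ((p : ℤ) ^ σ)))) hx
  equivariant g x := κ.shapiroToEisensteinLevelMap_equivariant t hts hm σ k hσ hle g x

end Literature.NumberTheory.EllipticCurves.ZpExtension

end
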